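import Mathlib
import HarnessLib
import Literature.Analysis.FluidPDE.TypeIAncientMild
import Literature.Analysis.FluidPDE.VorticityCalculus
import Literature.Analysis.FluidPDE.BarkerPrange2020VorticityAlignmentTypeIHolds
import Summits.NavierStokesRegularity.NavierStokesRegularity.Theorems.PoloidalWindowDoorPoloidalWindowRigidityWindow
import Summits.NavierStokesRegularity.NavierStokesRegularity.Theorems.PoloidalWindowDoorPoloidalWindowRigidityFirstIntegral
import Summits.NavierStokesRegularity.NavierStokesRegularity.Theorems.PoloidalWindowDoorPoloidalWindowRigidityLoopTangencyPin

/-!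
# Route `PoloidalWindowDoor`, crux `PoloidalWindowRigidity` (K2, stmt-NavierStokesRegularity-19708) — LINE 14 `loop_island`
# (ns-idea-8 g7, lens «barrier»), STUB D `stub_discDichotomy`: ISLAND OR FLAT PLANE

Cell ns-regularity-ideate, seat ns-poloidal-K2-p2 g12 (stub-worker on K2; `--supports` the crux item).  Statement VERBATIM
`Cruxes/PoloidalWindowRigidity/Lines/loop_island.lean` (ad8f96e88fc9) l.141–160.

Setting: a profile of the route's Type-I class (rate, continuity on the open slab, Oseen-mildness (M), incompressibility), e₃-poloidal at
all times; a time `s < 0`; a non-stationary `ℓ`-periodic orbit `γ` of `curl v(s)`; and a «Jordan region» `O` for it: open, bounded, meeting the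
plane `P = {y₂ = (γ 0)₂}`, and such that every point of `closure O ∩ P` outside `O` lies on `range γ`.  CONCLUSION: either an ISLAND BRACKET of
`±v₂(s,·)` on `P` (the shape of `…HotLoopsReduction.zero_of_island` / `NoIslands`), or `v₂(s,·)` is CONSTANT on `P`.

PROOF.  (1) The orbit is planar and `w := v₂(s,·)` is constant `= c := w(γ 0)` along it: `θ ↦ (γ θ)₂` and `θ ↦ w(γ θ)` have zero
derivative — poloidality `(curl v(s))₂ = 0` and the FROZEN LAW `(Dv(s)·curl v(s))₂ = 0` (tree `…FirstIntegral.stub_firstIntegral`), integrated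
by `…LoopTangencyPin.apply_integralCurve_eq`.  (2) If `w = c` on `O ∩ P` (relatively open, nonempty), then `w ≡ c` on `P`: the slice `v(s,·)` is
real-analytic on `ℝ³` (tree `IsTypeIAncientMild.analyticOnNhd_slice_univ`), so `a ↦ w(a₀, a₁, z₁)` is real-analytic on the connected `ℝ²` and the
identity theorem applies.  (3) Otherwise pick `y₀ ∈ O ∩ P` with `w y₀ ≠ c`, `σ := ±1` with `σ w y₀ > σ c`; on the compact nonempty
`D̄ := closure O ∩ P` the continuous `σw` attains its maximum `M ≥ σ w y₀ > σc` on `K := D̄ ∩ {σw = M}` (compact, nonempty); `K ⊆ O` because a point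
of `D̄ ∖ O` lies on `range γ` where `σw = σc < M`; with guard `O` this is an island bracket.  Extreme value theorem + identity theorem; size S/M.

WHAT THIS IS NOT: not a claim about Navier–Stokes regularity — one provable stub of an ideator line of a door route (bears_on LADDER-NS N0,
rung N0-LocalTubeDoorPoloidal); the line's other stubs (J Jordan, Z persistence, Y layered rigidity) and the residues S0 / HL3′ / NoIslands
are not touched; crux 19708 and items 20428 / 27893 / 22881 stay OPEN.
-/

noncomputable section

-- the summit and its single sub-problem share the name (CONVENTIONS §1), as in every Theorems file
set_option linter.dupNamespace false

namespace Summit.NavierStokesRegularity.NavierStokesRegularity.Theorems.PoloidalWindowDoorPoloidalWindowRigidityDiscDichotomy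

open MeasureTheory Set Function Filter Topology Metric
open scoped RealInnerProductSpace InnerProductSpace
open Literature.Analysis Literature.Analysis.FluidPDE
open Summit.NavierStokesRegularity.NavierStokesRegularity.Theorems.PoloidalWindowDoorPoloidalWindowRigidityWindow
open Summit.NavierStokesRegularity.NavierStokesRegularity.Theorems.PoloidalWindowDoorPoloidalWindowRigidityFirstIntegral
open Summit.NavierStokesRegularity.NavierStokesRegularity.Theorems.PoloidalWindowDoorPoloidalWindowRigidityLoopTangencyPin

/-- The horizontal plane `{y₂ = z}` is parametrised by `ℝ²`: `a ↦ (a₀, a₁, z)` written with `EuclideanSpace.single`. [folklore] -/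
theorem plane_point_eq (y : EuclideanSpace ℝ (Fin 3)) :
    y = EuclideanSpace.single 0 (y 0) + EuclideanSpace.single 1 (y 1) + EuclideanSpace.single 2 (y 2) := by
  ext i
  fin_cases i <;> simp

/-- **Identity theorem on a horizontal plane for a real-analytic function on `ℝ³`**: if `f` is real-analytic on `ℝ³` and equals the
constant `c` on `O ∩ {y₂ = z}` for an open `O` meeting the plane, then `f = c` on the whole plane. [folklore] -/
theorem eq_const_on_plane_of_analytic {f : EuclideanSpace ℝ (Fin 3) → ℝ} (hf : AnalyticOnNhd ℝ f univ)
    {O : Set (EuclideanSpace ℝ (Fin 3))} (hO : IsOpen O) {z c : ℝ} (hne : ∃ y ∈ O, y 2 = z)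
    (hc : ∀ y ∈ O, y 2 = z → f y = c) :
    ∀ y : EuclideanSpace ℝ (Fin 3), y 2 = z → f y = c := by
  -- the affine chart of the plane
  let emb : EuclideanSpace ℝ (Fin 2) → EuclideanSpace ℝ (Fin 3) := fun a =>
    EuclideanSpace.single 0 (a 0) + EuclideanSpace.single 1 (a 1) + EuclideanSpace.single 2 z
  have hemb2 : ∀ a, emb a 2 = z := fun a => by simp [emb]
  have hemb_of : ∀ y : EuclideanSpace ℝ (Fin 3), y 2 = z →
      emb (EuclideanSpace.single 0 (y 0) + EuclideanSpace.single 1 (y 1)) = y := by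
    intro y hy
    rw [plane_point_eq y, hy]
    simp [emb]
  -- `emb = L + const` with `L` continuous linear
  let L : EuclideanSpace ℝ (Fin 2) →L[ℝ] EuclideanSpace ℝ (Fin 3) :=
    (EuclideanSpace.proj (𝕜 := ℝ) (0 : Fin 2)).smulRight (EuclideanSpace.single 0 1) +
      (EuclideanSpace.proj (𝕜 := ℝ) (1 : Fin 2)).smulRight (EuclideanSpace.single 1 1)
  have hL : ∀ a, emb a = L a + EuclideanSpace.single 2 z := by
    intro a
    ext i
    fin_cases i <;> simp [emb, L]
  have hemb_eq : emb = fun a => L a + EuclideanSpace.single 2 z := funext hL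
  have hemb_cont : Continuous emb := by
    rw [hemb_eq]; exact L.continuous.add continuous_const
  have hemb_an : AnalyticOnNhd ℝ emb univ := by
    rw [hemb_eq]; exact fun a _ => (L.analyticAt a).add analyticAt_const
  -- the planar function
  have hg : AnalyticOnNhd ℝ (f ∘ emb) univ := hf.comp hemb_an (fun _ _ => mem_univ _)
  obtain ⟨y₁, hy₁O, hy₁z⟩ := hne
  set a₁ : EuclideanSpace ℝ (Fin 2) := EuclideanSpace.single 0 (y₁ 0) + EuclideanSpace.single 1 (y₁ 1) with ha₁
  have hga : f ∘ emb =ᶠ[𝓝 a₁] fun _ => c := by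
    have hU : IsOpen (emb ⁻¹' O) := hO.preimage hemb_cont
    have ha₁U : a₁ ∈ emb ⁻¹' O := by
      show emb a₁ ∈ O
      rw [ha₁, hemb_of y₁ hy₁z]; exact hy₁O
    filter_upwards [hU.mem_nhds ha₁U] with a ha
    exact hc (emb a) ha (hemb2 a)
  have hEq : EqOn (f ∘ emb) (fun _ => c) univ :=
    hg.eqOn_of_preconnected_of_eventuallyEq analyticOnNhd_const isPreconnected_univ (mem_univ a₁) hga
  intro y hy
  have h := hEq (mem_univ (EuclideanSpace.single 0 (y 0) + EuclideanSpace.single 1 (y 1)))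
  simp only [comp_apply, hemb_of y hy] at h
  exact h

/-- **STUB D `stub_discDichotomy` of LINE 14 `loop_island` (VERBATIM): ISLAND OR FLAT PLANE.**  See the module docstring for the proof. -/
theorem stub_discDichotomy :
    ∀ (C : ℝ) (v : ℝ → EuclideanSpace ℝ (Fin 3) → EuclideanSpace ℝ (Fin 3)),
      Literature.Analysis.FluidPDE.HasTypeITimeDecay C v →
      ContinuousOn (Function.uncurry v) (Set.Iio (0 : ℝ) ×ˢ Set.univ) →
      (∀ s t : ℝ, s < t → t < 0 → ∀ x, v t x =
        Literature.Analysis.UnboundedOperators.heatExtension (v s) (t - s) x -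
          Literature.Analysis.FluidPDE.oseenDuhamel 1 s v v t x) →
      (∀ t < 0, Literature.Analysis.FluidPDE.VectorCalculus.IsDivFree (v t)) →
      (∀ s < 0, ∀ y, ⟪Literature.Analysis.FluidPDE.curl (v s) y, EuclideanSpace.single 2 1⟫_ℝ = 0) →
      ∀ s : ℝ, s < 0 → ∀ (γ : ℝ → EuclideanSpace ℝ (Fin 3)) (ℓ : ℝ), 0 < ℓ →
        (∀ θ, HasDerivAt γ (Literature.Analysis.FluidPDE.curl (v s) (γ θ)) θ) → (∀ θ, γ (θ + ℓ) = γ θ) →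
        Literature.Analysis.FluidPDE.curl (v s) (γ 0) ≠ 0 →
        ∀ O : Set (EuclideanSpace ℝ (Fin 3)), IsOpen O → Bornology.IsBounded O → (∃ y ∈ O, y 2 = γ 0 2) →
          (∀ y ∈ closure O, y 2 = γ 0 2 → y ∉ O → y ∈ Set.range γ) →
          (∃ (σ M : ℝ) (K O' : Set (EuclideanSpace ℝ (Fin 3))),
              (σ = 1 ∨ σ = -1) ∧ IsCompact K ∧ K.Nonempty ∧ (∀ y ∈ K, y 2 = γ 0 2 ∧ σ * v s y 2 = M) ∧
                IsOpen O' ∧ K ⊆ O' ∧ (∀ y ∈ O', y 2 = γ 0 2 → σ * v s y 2 ≤ M) ∧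
                (∀ y ∈ O', y 2 = γ 0 2 → σ * v s y 2 = M → y ∈ K)) ∨
            (∀ y : EuclideanSpace ℝ (Fin 3), y 2 = γ 0 2 → v s y 2 = v s (γ 0) 2) := by
  intro C v hrate hcont hmild hdiv hpol s hs γ ℓ _hℓ hγ _hper _hne O hO hbdd hOP hfr
  -- smoothness and analyticity of the slice `v s`
  have hA : IsTypeIAncientMild C v := isTypeIAncientMild_of_class hrate hcont hmild hdiv
  have hvs : ContDiff ℝ (⊤ : ℕ∞) (v s) := hA.contDiff_slice hs
  have hv2 : ContDiff ℝ 2 (v s) := contDiff_infty.1 hvs 2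
  have hvd : Differentiable ℝ (v s) := hv2.differentiable two_ne_zero
  have hwcont : Continuous fun y => v s y 2 := (contDiff_apply_coord_vec3 hv2 2).continuous
  have hwan : AnalyticOnNhd ℝ (fun y => v s y 2) univ := fun y _ =>
    ((EuclideanSpace.proj (𝕜 := ℝ) (2 : Fin 3)).analyticAt _).comp (hA.analyticOnNhd_slice_univ hs y (mem_univ _))
  -- the frozen law and poloidality at time `s`
  have hfrozen : ∀ y, fderiv ℝ (v s) y (curl (v s) y) 2 = 0 := fun y => by
    have h := stub_firstIntegral C v hrate hcont hmild hdiv (EuclideanSpace.single 2 1) hpol s hs y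
    simpa [EuclideanSpace.inner_single_right] using h
  have hpol1 : ∀ y, curl (v s) y 2 = 0 := fun y => by
    have h := hpol s hs y
    simpa [EuclideanSpace.inner_single_right] using h
  -- (1) the orbit is planar and `v₂(s,·)` is constant along it
  set z₁ : ℝ := γ 0 2 with hz₁
  set c : ℝ := v s (γ 0) 2 with hc
  have hγI : ∀ θ : ℝ, ∀ t ∈ Ioo (-(|θ| + 1)) (|θ| + 1), HasDerivAt γ (curl (v s) (γ t)) t :=
    fun θ t _ => hγ t
  have hθI : ∀ θ : ℝ, θ ∈ Ioo (-(|θ| + 1)) (|θ| + 1) := fun θ =>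
    ⟨by linarith [neg_abs_le θ], by linarith [le_abs_self θ]⟩
  have hγ2 : ∀ θ, γ θ 2 = z₁ := fun θ => by
    have hφ : Differentiable ℝ (⇑(EuclideanSpace.proj (𝕜 := ℝ) (2 : Fin 3))) :=
      (EuclideanSpace.proj (𝕜 := ℝ) (2 : Fin 3)).differentiable
    have hφX : ∀ y, fderiv ℝ (⇑(EuclideanSpace.proj (𝕜 := ℝ) (2 : Fin 3))) y (curl (v s) y) = 0 := fun y => by
      rw [(EuclideanSpace.proj (𝕜 := ℝ) (2 : Fin 3)).fderiv]
      simpa using hpol1 y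
    have h := apply_integralCurve_eq (hγI θ) hφ hφX (hθI θ)
    simpa using h
  have hγc : ∀ θ, v s (γ θ) 2 = c := fun θ => by
    have hφ : Differentiable ℝ (fun y => v s y 2) := (contDiff_apply_coord_vec3 hv2 2).differentiable two_ne_zero
    have hφX : ∀ y, fderiv ℝ (fun y => v s y 2) y (curl (v s) y) = 0 := fun y => by
      rw [fderiv_apply_coord_vec3 (hvd y) 2]
      exact hfrozen y
    exact apply_integralCurve_eq (hγI θ) hφ hφX (hθI θ)
  have hrange : ∀ y ∈ Set.range γ, v s y 2 = c := by
    rintro y ⟨θ, rfl⟩; exact hγc θ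
  -- (2)/(3) the dichotomy
  by_cases hflat : ∀ y ∈ O, y 2 = z₁ → v s y 2 = c
  · exact Or.inr (eq_const_on_plane_of_analytic hwan hO hOP hflat)
  · left
    push Not at hflat
    obtain ⟨y₀, hy₀O, hy₀z, hy₀c⟩ := hflat
    -- the sign
    obtain ⟨σ, hσ, hσpos⟩ : ∃ σ : ℝ, (σ = 1 ∨ σ = -1) ∧ σ * c < σ * v s y₀ 2 := by
      rcases lt_or_gt_of_ne hy₀c with h | h
      · exact ⟨-1, Or.inr rfl, by linarith⟩
      · exact ⟨1, Or.inl rfl, by linarith⟩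
    -- the compact planar closure `D̄ := closure O ∩ P`
    set D : Set (EuclideanSpace ℝ (Fin 3)) := closure O ∩ {y | y 2 = z₁} with hD
    have hPc : IsClosed {y : EuclideanSpace ℝ (Fin 3) | y 2 = z₁} :=
      isClosed_eq (EuclideanSpace.proj (𝕜 := ℝ) (2 : Fin 3)).continuous continuous_const
    have hDc : IsCompact D :=
      (Metric.isCompact_of_isClosed_isBounded isClosed_closure hbdd.closure).inter_right hPc
    have hy₀D : y₀ ∈ D := ⟨subset_closure hy₀O, hy₀z⟩
    have hDne : D.Nonempty := ⟨y₀, hy₀D⟩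
    -- the maximum of `σ w` on `D̄`
    have hσw : Continuous fun y => σ * v s y 2 := continuous_const.mul hwcont
    obtain ⟨ym, hymD, hmax⟩ := hDc.exists_isMaxOn hDne hσw.continuousOn
    set M : ℝ := σ * v s ym 2 with hM
    have hMge : ∀ y ∈ D, σ * v s y 2 ≤ M := fun y hy => hmax hy
    have hMc : σ * c < M := lt_of_lt_of_le hσpos (hMge y₀ hy₀D)
    set K : Set (EuclideanSpace ℝ (Fin 3)) := D ∩ {y | σ * v s y 2 = M} with hK
    have hKc : IsCompact K := hDc.inter_right (isClosed_eq hσw continuous_const)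
    have hKne : K.Nonempty := ⟨ym, hymD, rfl⟩
    have hKO : K ⊆ O := by
      intro y hy
      by_contra hyO
      have hyr : y ∈ Set.range γ := hfr y hy.1.1 hy.1.2 hyO
      have h1 : σ * v s y 2 = M := hy.2
      rw [hrange y hyr] at h1
      exact absurd h1 (ne_of_lt hMc)
    refine ⟨σ, M, K, O, hσ, hKc, hKne, fun y hy => ⟨hy.1.2, hy.2⟩, hO, hKO, fun y hyO hyz => ?_,
      fun y hyO hyz hyM => ?_⟩
    · exact hMge y ⟨subset_closure hyO, hyz⟩
    · exact ⟨⟨subset_closure hyO, hyz⟩, hyM⟩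

end Summit.NavierStokesRegularity.NavierStokesRegularity.Theorems.PoloidalWindowDoorPoloidalWindowRigidityDiscDichotomy
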